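import Summits.QuantumFields.BalabanUV.T4Continuum.Spine.NE1p.TiltedMeanCrossover
import Summits.QuantumFields.BalabanUV.T4Continuum.Spine.NE7.QLaBudget

/-!
# T⁴ programme, spine estimate NE1′ (node O3b/H2) — the INFLUENCE of one slot on a tilted first moment: centred × decoupled ⇒
# SECOND order in the slot's amplitude, uniformly on the tilt window; the squared-amplitude ledger gives `OldInfluenceBudget`

Cell `pub-balaban-gaps` (YM blitz Y1, track G2), seat `ne1` gen 4 (prover-pub-balaban-gaps-ne1-g4-0), record `HOME/ne/NE1.md`
§4 rows R32–R34 (gen 4).  ADDITIVE — imports the seat's gen-3 `TiltedMeanCrossover` (p343997 ✓: `OldInfluenceBudget`, hence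
gen 2's `DressedMGFForm.tiltedMean`) and seat ne7's `Spine/NE7/QLaBudget` (p340302 ✓: the letters `rate_secondOrder_lt_one`,
`one_lt_rate_firstOrder`) ONLY; modifies nothing.  Sibling (same generation): `TiltedMeanInfluenceModel` (N decoupled slots; gen 3's
four shapes inhabited with the old budgets holding by the mechanism).

WHAT THIS IS.  Gen 3 (NE1.md R28) argued ON PAPER, in three currencies, that the one item NE7 v3 relocated to NE1′ — the
first-order channel of the field-dependent dressed terms — is not idea-bound: in the consumer's INTEGRATED currency the
influence of re-sampling an OLD component on the source-tilted first moment of the unit loop is a COVARIANCE of two centred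
factors, hence second order in the loop's sensitivity `θ₁^{K−j}`, summable against the multiplicity `Λ^{K−j}` of scale-`j`
components (`a = θ₁²Λ = L⁻² < 1` in `d = 4`), the inputs being {conjugation symmetry [kernel `T4AdInvariant`], decoupling
[B13 §§1–2 KIND], squared cost [B13 (2.20)]}.  This file makes the MECHANISM a kernel theorem in the exactly-decoupled
(product-law) setting, on the binder's own object `tiltedMean`:
* §1 [one term] `s ↦ tiltedMean F ν s` is differentiable with derivative the tilted VARIANCE (Mathlib `variance_tilted_mul`),
  which is `≤ B²` for `|F| ≤ B` (Popoviciu, Mathlib `variance_le_sq_of_bounded`); hence the tilted mean is `B²`-Lipschitz in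
  the tilt (`abs_tiltedMean_sub_le`) and a CENTRED term (`∫F dν = 0`) has `|tiltedMean F ν s| ≤ B²·|s|` on the whole tilt
  window (`abs_tiltedMean_le_of_centred`) — against the uncentred first-order size `|tiltedMean F ν s| ≤ B`
  (`abs_tiltedMean_le`).  This is the located reason why matching first moments at `s = 0` alone does not feed the consumer
  (NE1.md R23 (a)) while CENTRED slot contributions propagate to all tilts at second-order cost.
* §2 [exact decoupling] under a product law the tilted mean of a sum SPLITS: `tiltedMean (G ⊕ h) (ρ ⊗ κ) s = tiltedMean G ρ s
  + tiltedMean h κ s` (`tiltedMean_prod_add`, Fubini `integral_prod_mul`; the N-slot form is in the sibling `TiltedMeanInfluenceModel`).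
* §3 [the influence of one slot] re-sampling ONE decoupled slot (`κ_A ↦ κ_B`, the rest `ρ` untouched) moves the tilted mean
  of `G ⊕ h` by exactly `tiltedMean h κ_B s − tiltedMean h κ_A s` (`influence_eq`): `≤ 2a` for `|h| ≤ a` always
  (`abs_influence_le`, FIRST order) and `≤ 2a²·|s|` when both slot laws centre `h` (`abs_influence_le_of_centred`, SECOND order).
* §4 [pure sums, the ledger level] per-slot influence bounds `|Δ X| ≤ 2|s|·(amp X)²` with slice sums
  `Σ_{sc X = j} (amp X)² ≤ vol·c·b^{K−j}` give gen 3's `OldInfluenceBudget … vol (2·l₀·c) b` (`oldInfluenceBudget_of_sq_amplitudes`);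
  with per-slot amplitudes `amp X ≤ c₁·θ₁^{K − sc X}` and slot counts `#{sc X = j} ≤ vol·Λ^{K−j}` the ratio is `b = θ₁²·Λ`
  (`oldInfluenceBudget_of_amplitudes`) — `= L⁻² < 1` for `θ₁ = L⁻³`, `Λ = L⁴` (ne7's `QLaBudget.rate_secondOrder_lt_one`),
  whereas the uncentred first-order bounds `|Δ X| ≤ 2·amp X` give the ratio `θ₁·Λ = L > 1` (`one_lt_rate_firstOrder`): the
  kernel form of «only second-order bookings close» (NE1.md R2 ∕ R28).
* §5 [the general law — WHERE DECOUPLING ENTERS] for ANY finite law `ν` and any re-weighting by a density ratio `r ≥ 0` (the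
  re-sampled law `ν.withDensity r`; no product structure) the influence on the tilted mean is EXACTLY a tilted covariance over a
  tilted mean, `tiltedMean F (ν.withDensity r) s − tiltedMean F ν s = Cov_{ν_s}(F, r) ∕ E_{ν_s}[r]`, `ν_s = ν.tilted (sF)` normalised
  (`influence_eq_cov_div`).  So a producer's whole input for one slot is a bound on the covariance of the loop variable with the
  slot-local density ratio under the TILTED class law — for a product law and `F = G ⊕ h` it reduces to the slot's own terms (§3);
  for Bałaban's class-conditioned laws it is the cluster-expansion decoupling of the far holonomy from the slot ([B13] §§1–2 KIND)
  plus §1's second order for the near part.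
* §6 [consistency] for a product law and a SLOT-LOCAL density ratio the two descriptions agree: `(ρ ⊗ κ).withDensity (q ∘ snd)
  = ρ ⊗ κ.withDensity q` (Mathlib `prod_withDensity_right`), so §5's re-weighting influence IS §3's slot influence
  (`influence_withDensity_snd`).
So of R28 (3)'s four inputs, symmetry (`T4AdInvariant`) and «second order on the whole tilt window» (this file) are kernel; what
a producer for Bałaban's runs must supply is the DECOUPLING (here exact = product law; there the cluster expansion of B13 §§1–2
with its exponentially small corrections) and the census of slots — NODE O's object.

HONEST FRAMING.  [folklore] measure theory (tilted measures, Fubini) and finite-sum bookkeeping over ABSTRACT ∕ PRODUCT data;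
NOTHING of Bałaban's is asserted or instantiated (his class-conditioned laws are not product laws; which ledger of localization
domains realises `ScaleLedger` is row NE1′'s OBJECT-bound content behind NODE O).  `OldInfluenceBudget` ∕ (QL-a) is NOT IN PRINT
for the d = 4 non-abelian model ([Balaban1989LargeFieldII] p. 356 defers observables).  NE1′ NOT proved; spine 0∕9; (B) 0∕13;
one fixed finite T⁴ — NOT ℝ⁴, NOT infinite volume, NOT a mass gap, NOT Clay.  0 sorry.
-/

noncomputable section

open Finset MeasureTheory ProbabilityTheory
open scoped BigOperators

namespace Summit.QuantumFields.BalabanUV.T4Continuum.NE1p.TiltedMeanInfluence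

open Summit.QuantumFields.BalabanUV.T4Continuum.NE1p.DressedMGFForm (tiltedMean deriv_cgf_eq_tiltedMean)
open Summit.QuantumFields.BalabanUV.T4Continuum.NE1p.TiltedMeanCrossover (OldInfluenceBudget)
open Summit.QuantumFields.BalabanUV.T4Continuum.Spine.NE7 (QLa)
open Literature.MathematicalPhysics.QuantumFieldTheory.Balaban1983to89

/-! ## §1 One term: the tilted mean as a function of the tilt — derivative = tilted variance ≤ B²; centred ⇒ second order -/

section OneTerm

variable {Ω : Type*} {mΩ : MeasurableSpace Ω} {ν : Measure Ω} [IsFiniteMeasure ν] {F : Ω → ℝ} {B : ℝ}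

/-- NUMERATOR ∕ DENOMINATOR FORM: `tiltedMean F ν s = ∫F e^{sF}dν ∕ ∫e^{sF}dν` (Mathlib `integral_tilted`; both sides `0` when
`ν = 0`). [folklore] -/
theorem tiltedMean_eq_div (F : Ω → ℝ) (ν : Measure Ω) (s : ℝ) :
    tiltedMean F ν s = (∫ ω, F ω * Real.exp (s * F ω) ∂ν) / ∫ ω, Real.exp (s * F ω) ∂ν := by
  rw [tiltedMean, integral_tilted, ← integral_div]
  refine integral_congr_ae (ae_of_all _ fun ω => ?_)
  simp only [smul_eq_mul]
  ring

/-- **THE TILT-DERIVATIVE OF THE TILTED MEAN IS THE TILTED VARIANCE** (`F` measurable, `|F| ≤ B`, `ν` finite):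
`d∕ds tiltedMean F ν s = Var[F; ν.tilted (sF)]` — fluctuation–response (Mathlib `integral_tilted_mul_self`, `variance_tilted_mul`,
`analyticAt_cgf`). [folklore] -/
theorem hasDerivAt_tiltedMean (hFm : Measurable F) (hF : ∀ ω, |F ω| ≤ B) (s : ℝ) :
    HasDerivAt (tiltedMean F ν) (Var[F; ν.tilted fun ω => s * F ω]) s := by
  have hmem : ∀ t, t ∈ interior (integrableExpSet F ν) := fun t =>
    T4GenFunBounds.mem_interior_integrableExpSet hFm.aemeasurable (ae_of_all _ hF) t
  have hfun : tiltedMean F ν = deriv (cgf F ν) := funext fun t => (deriv_cgf_eq_tiltedMean hFm hF t).symm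
  rw [hfun, variance_tilted_mul (hmem s), iteratedDeriv_succ, iteratedDeriv_one]
  exact (analyticAt_cgf (hmem s)).deriv.differentiableAt.hasDerivAt

/-- The tilted variance of a variable bounded by `B` is at most `B²` (the tilted law is a probability law, or zero; Popoviciu
`variance_le_sq_of_bounded` on `[−B, B]`). [folklore] -/
theorem variance_tilted_le_sq (hFm : Measurable F) (hF : ∀ ω, |F ω| ≤ B) (s : ℝ) :
    Var[F; ν.tilted fun ω => s * F ω] ≤ B ^ 2 := by
  rcases eq_zero_or_neZero ν with rfl | hν
  · simp only [tilted_zero_measure, variance_zero_measure]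
    positivity
  haveI : IsProbabilityMeasure (ν.tilted fun ω => s * F ω) :=
    isProbabilityMeasure_tilted (T4GenFunBounds.integrable_exp_mul_of_bound hFm.aemeasurable (ae_of_all _ hF) s)
  calc Var[F; ν.tilted fun ω => s * F ω] ≤ ((B - -B) / 2) ^ 2 :=
        variance_le_sq_of_bounded (ae_of_all _ fun ω => ⟨(abs_le.mp (hF ω)).1, (abs_le.mp (hF ω)).2⟩) hFm.aemeasurable
    _ = B ^ 2 := by ring

/-- **THE TILTED MEAN IS `B²`-LIPSCHITZ IN THE TILT**: `|tiltedMean F ν s − tiltedMean F ν s′| ≤ B²·|s − s′|` (mean value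
inequality with §1's derivative bound). [folklore] -/
theorem abs_tiltedMean_sub_le (hFm : Measurable F) (hF : ∀ ω, |F ω| ≤ B) (s s' : ℝ) :
    |tiltedMean F ν s - tiltedMean F ν s'| ≤ B ^ 2 * |s - s'| := by
  have hd : ∀ x ∈ (Set.univ : Set ℝ), DifferentiableAt ℝ (tiltedMean F ν) x :=
    fun x _ => (hasDerivAt_tiltedMean hFm hF x).differentiableAt
  have hb : ∀ x ∈ (Set.univ : Set ℝ), ‖deriv (tiltedMean F ν) x‖ ≤ B ^ 2 := fun x _ => by
    rw [(hasDerivAt_tiltedMean hFm hF x).deriv, Real.norm_eq_abs, abs_of_nonneg (variance_nonneg _ _)]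
    exact variance_tilted_le_sq hFm hF x
  have h := convex_univ.norm_image_sub_le_of_norm_deriv_le hd hb (Set.mem_univ s') (Set.mem_univ s)
  rwa [Real.norm_eq_abs, Real.norm_eq_abs] at h

omit [IsFiniteMeasure ν] in
/-- At zero tilt the tilted mean is the normalised mean; a CENTRED term (`∫F dν = 0`) has tilted mean `0` at `s = 0`. [folklore] -/
theorem tiltedMean_zero_of_centred (h0 : ∫ ω, F ω ∂ν = 0) : tiltedMean F ν 0 = 0 := by
  unfold tiltedMean
  simp only [zero_mul, tilted_const', integral_smul_measure, h0, smul_zero]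

/-- **CENTRED ⇒ SECOND ORDER ON THE WHOLE TILT WINDOW**: if `∫F dν = 0` (in the application: the slot's contribution is centred
under the class law by conjugation symmetry, kernel `T4AdInvariant.integral_eq_zero_of_conjEquivariant`) and `|F| ≤ B`, then
`|tiltedMean F ν s| ≤ B²·|s|` for EVERY tilt `s` — quadratic in the amplitude `B`, linear in the tilt. [folklore] -/
theorem abs_tiltedMean_le_of_centred (hFm : Measurable F) (hF : ∀ ω, |F ω| ≤ B) (h0 : ∫ ω, F ω ∂ν = 0) (s : ℝ) :
    |tiltedMean F ν s| ≤ B ^ 2 * |s| := by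
  have h := abs_tiltedMean_sub_le (ν := ν) hFm hF s 0
  rwa [tiltedMean_zero_of_centred h0, sub_zero, sub_zero] at h

omit [IsFiniteMeasure ν] in
/-- The UNCENTRED, FIRST-ORDER size: `|tiltedMean F ν s| ≤ B` for `|F| ≤ B`, `0 ≤ B` (the tilted law has mass `≤ 1`). [folklore] -/
theorem abs_tiltedMean_le (hF : ∀ ω, |F ω| ≤ B) (hB : 0 ≤ B) (s : ℝ) : |tiltedMean F ν s| ≤ B := by
  unfold tiltedMean
  have h1 : ‖∫ ω, F ω ∂(ν.tilted fun ω => s * F ω)‖ ≤ B * (ν.tilted fun ω => s * F ω).real Set.univ :=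
    norm_integral_le_of_norm_le_const (ae_of_all _ fun ω => by rw [Real.norm_eq_abs]; exact hF ω)
  rw [Real.norm_eq_abs] at h1
  refine h1.trans ?_
  calc B * (ν.tilted fun ω => s * F ω).real Set.univ ≤ B * 1 :=
        mul_le_mul_of_nonneg_left (measureReal_le_one) hB
    _ = B := mul_one B

end OneTerm

/-! ## §2 Exact decoupling: under a product law the tilted mean of a sum splits -/

section Decoupling

variable {Ω S : Type*} {mΩ : MeasurableSpace Ω} {mS : MeasurableSpace S}
  {ρ : Measure Ω} {κ : Measure S} [IsFiniteMeasure ρ] [IsFiniteMeasure κ] {G : Ω → ℝ} {h : S → ℝ} {B a : ℝ}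

/-- Bounded measurable `X` on a finite measure: `X·e^{sX}` is integrable. [folklore] -/
theorem integrable_mul_exp_mul {X : Ω → ℝ} (hXm : Measurable X) (hX : ∀ ω, |X ω| ≤ B) (s : ℝ) :
    Integrable (fun ω => X ω * Real.exp (s * X ω)) ρ :=
  (T4GenFunBounds.integrable_exp_mul_of_bound hXm.aemeasurable (ae_of_all _ hX) s).bdd_mul
    hXm.aestronglyMeasurable (ae_of_all _ fun ω => by rw [Real.norm_eq_abs]; exact hX ω)

/-- **DECOUPLING.**  `ρ` on `Ω` and `κ` on `S` finite and nonzero, `G`, `h` bounded measurable.  Under the PRODUCT law the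
tilted mean of `G ⊕ h := (ω, x) ↦ G ω + h x` splits: `tiltedMean (G ⊕ h) (ρ ⊗ κ) s = tiltedMean G ρ s + tiltedMean h κ s`
(the tilt `e^{s(G+h)} = e^{sG}·e^{sh}` factorises; Fubini `integral_prod_mul`). [folklore] -/
theorem tiltedMean_prod_add [NeZero ρ] [NeZero κ] (hGm : Measurable G) (hG : ∀ ω, |G ω| ≤ B) (hhm : Measurable h)
    (hh : ∀ x, |h x| ≤ a) (s : ℝ) :
    tiltedMean (fun p : Ω × S => G p.1 + h p.2) (ρ.prod κ) s = tiltedMean G ρ s + tiltedMean h κ s := by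
  have hZG : 0 < ∫ ω, Real.exp (s * G ω) ∂ρ := T4GenFunBounds.mgf_pos_of_abs_le hGm.aemeasurable (ae_of_all _ hG) s
  have hZh : 0 < ∫ x, Real.exp (s * h x) ∂κ := T4GenFunBounds.mgf_pos_of_abs_le hhm.aemeasurable (ae_of_all _ hh) s
  have hiG := T4GenFunBounds.integrable_exp_mul_of_bound (μ := ρ) hGm.aemeasurable (ae_of_all _ hG) s
  have hih := T4GenFunBounds.integrable_exp_mul_of_bound (μ := κ) hhm.aemeasurable (ae_of_all _ hh) s
  have hiGG := integrable_mul_exp_mul (ρ := ρ) hGm hG s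
  have hihh := integrable_mul_exp_mul (ρ := κ) hhm hh s
  -- numerator and denominator of the product term
  have hnum : ∫ p, (G p.1 + h p.2) * Real.exp (s * (G p.1 + h p.2)) ∂(ρ.prod κ)
      = (∫ ω, G ω * Real.exp (s * G ω) ∂ρ) * (∫ x, Real.exp (s * h x) ∂κ)
        + (∫ ω, Real.exp (s * G ω) ∂ρ) * (∫ x, h x * Real.exp (s * h x) ∂κ) := by
    have hsplit : (fun p : Ω × S => (G p.1 + h p.2) * Real.exp (s * (G p.1 + h p.2)))
        = fun p => (G p.1 * Real.exp (s * G p.1)) * Real.exp (s * h p.2)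
          + Real.exp (s * G p.1) * (h p.2 * Real.exp (s * h p.2)) := by
      funext p; rw [mul_add, Real.exp_add]; ring
    rw [hsplit, integral_add (hiGG.mul_prod hih) (hiG.mul_prod hihh)]
    exact congrArg₂ (· + ·)
      (integral_prod_mul (fun ω => G ω * Real.exp (s * G ω)) fun x => Real.exp (s * h x))
      (integral_prod_mul (fun ω => Real.exp (s * G ω)) fun x => h x * Real.exp (s * h x))
  have hden : ∫ p, Real.exp (s * (G p.1 + h p.2)) ∂(ρ.prod κ)
      = (∫ ω, Real.exp (s * G ω) ∂ρ) * (∫ x, Real.exp (s * h x) ∂κ) := by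
    have hsplit : (fun p : Ω × S => Real.exp (s * (G p.1 + h p.2)))
        = fun p => Real.exp (s * G p.1) * Real.exp (s * h p.2) := by
      funext p; rw [mul_add, Real.exp_add]
    rw [hsplit]
    exact integral_prod_mul (fun ω => Real.exp (s * G ω)) fun x => Real.exp (s * h x)
  rw [tiltedMean_eq_div, tiltedMean_eq_div, tiltedMean_eq_div, hnum, hden, div_add_div _ _ hZG.ne' hZh.ne']

end Decoupling

/-! ## §3 The influence of re-sampling one decoupled slot: first order in general, second order when centred -/

section Influence

variable {Ω S : Type*} {mΩ : MeasurableSpace Ω} {mS : MeasurableSpace S}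
  {ρ : Measure Ω} {κA κB : Measure S} [IsFiniteMeasure ρ] [IsFiniteMeasure κA] [IsFiniteMeasure κB]
  {G : Ω → ℝ} {h : S → ℝ} {B a : ℝ}

/-- **THE INFLUENCE OF ONE SLOT.**  Re-sampling a decoupled slot — replacing its law `κ_A` by `κ_B`, the rest `ρ` untouched —
moves the tilted mean of `G ⊕ h` by EXACTLY the difference of the slot's own tilted means: the rest cancels. [folklore] -/
theorem influence_eq [NeZero ρ] [NeZero κA] [NeZero κB] (hGm : Measurable G) (hG : ∀ ω, |G ω| ≤ B)
    (hhm : Measurable h) (hh : ∀ x, |h x| ≤ a) (s : ℝ) :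
    tiltedMean (fun p : Ω × S => G p.1 + h p.2) (ρ.prod κB) s - tiltedMean (fun p : Ω × S => G p.1 + h p.2) (ρ.prod κA) s
      = tiltedMean h κB s - tiltedMean h κA s := by
  rw [tiltedMean_prod_add hGm hG hhm hh, tiltedMean_prod_add hGm hG hhm hh]
  ring

/-- FIRST ORDER, ALWAYS: the influence of a slot of amplitude `a` (`|h| ≤ a`, `0 ≤ a`) is at most `2a`. [folklore] -/
theorem abs_influence_le [NeZero ρ] [NeZero κA] [NeZero κB] (hGm : Measurable G) (hG : ∀ ω, |G ω| ≤ B)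
    (hhm : Measurable h) (hh : ∀ x, |h x| ≤ a) (ha : 0 ≤ a) (s : ℝ) :
    |tiltedMean (fun p : Ω × S => G p.1 + h p.2) (ρ.prod κB) s
      - tiltedMean (fun p : Ω × S => G p.1 + h p.2) (ρ.prod κA) s| ≤ 2 * a := by
  rw [influence_eq hGm hG hhm hh]
  have hA := abs_tiltedMean_le (ν := κA) hh ha s
  have hB := abs_tiltedMean_le (ν := κB) hh ha s
  calc |tiltedMean h κB s - tiltedMean h κA s| ≤ |tiltedMean h κB s| + |tiltedMean h κA s| := abs_sub _ _
    _ ≤ 2 * a := by linarith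

/-- **SECOND ORDER WHEN CENTRED**: if both slot laws centre the slot's contribution (`∫h dκ_A = ∫h dκ_B = 0`) then the influence
is at most `2a²·|s|` at tilt `s` — quadratic in the amplitude, uniformly small on a bounded tilt window. [folklore] -/
theorem abs_influence_le_of_centred [NeZero ρ] [NeZero κA] [NeZero κB] (hGm : Measurable G) (hG : ∀ ω, |G ω| ≤ B)
    (hhm : Measurable h) (hh : ∀ x, |h x| ≤ a) (h0A : ∫ x, h x ∂κA = 0) (h0B : ∫ x, h x ∂κB = 0) (s : ℝ) :
    |tiltedMean (fun p : Ω × S => G p.1 + h p.2) (ρ.prod κB) s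
      - tiltedMean (fun p : Ω × S => G p.1 + h p.2) (ρ.prod κA) s| ≤ 2 * a ^ 2 * |s| := by
  rw [influence_eq hGm hG hhm hh]
  have hA := abs_tiltedMean_le_of_centred (ν := κA) hhm hh h0A s
  have hB := abs_tiltedMean_le_of_centred (ν := κB) hhm hh h0B s
  calc |tiltedMean h κB s - tiltedMean h κA s| ≤ |tiltedMean h κB s| + |tiltedMean h κA s| := abs_sub _ _
    _ ≤ 2 * a ^ 2 * |s| := by linarith

end Influence

/-! ## §4 The ledger level (pure sums): squared amplitudes against slot counts give `OldInfluenceBudget` with ratio `θ₁²Λ` -/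

section Ledger

variable {ι D : Type*} [DecidableEq ι] {l₀ vol : ℝ} {T : ℕ → Finset ι} {Bad : ℕ → ℝ → Finset ι}
  {wf : ℕ → ι → Finset D} {sc : ℕ → D → ℕ} {Δ : ℕ → ℝ → ι → ℝ → D → ℝ}

/-- **SQUARED-AMPLITUDE LEDGER ⇒ `OldInfluenceBudget`.**  If on every good class and every tilt `|s| ≤ l₀` each slot's influence
is second order, `|Δ K t τ s X| ≤ 2|s|·(amp K X)²` (§3), and the scale-`j` slice sums of the squared amplitudes are at most
`vol·c·b^{K−j}`, then gen 3's one-run budget holds with size constant `2·l₀·c` and ratio `b` (no sign conditions needed):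
`OldInfluenceBudget l₀ T Bad wf sc Δ vol (2·l₀·c) b`. [folklore] -/
theorem oldInfluenceBudget_of_sq_amplitudes {amp : ℕ → D → ℝ} {c b : ℝ}
    (hΔ : ∀ K (t : ℝ), |t| ≤ l₀ → ∀ τ ∈ T K \ Bad K t, ∀ s : ℝ, |s| ≤ l₀ →
      ∀ X ∈ wf K τ, |Δ K t τ s X| ≤ 2 * |s| * amp K X ^ 2)
    (hamp : ∀ K (τ : ι), ∀ j ≤ K, ∑ X ∈ wf K τ with sc K X = j, amp K X ^ 2 ≤ vol * (c * b ^ (K - j))) :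
    OldInfluenceBudget l₀ T Bad wf sc Δ vol (2 * l₀ * c) b := by
  intro K t ht τ hτ s hs j hj
  have hs0 : 0 ≤ |s| := abs_nonneg s
  calc ∑ X ∈ wf K τ with sc K X = j, |Δ K t τ s X - 0|
      ≤ ∑ X ∈ wf K τ with sc K X = j, 2 * |s| * amp K X ^ 2 :=
        sum_le_sum fun X hX => by rw [sub_zero]; exact hΔ K t ht τ hτ s hs X (mem_filter.mp hX).1
    _ = 2 * |s| * ∑ X ∈ wf K τ with sc K X = j, amp K X ^ 2 := by rw [mul_sum]
    _ ≤ 2 * l₀ * (vol * (c * b ^ (K - j))) :=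
        mul_le_mul (by linarith) (hamp K τ j hj) (sum_nonneg fun X _ => sq_nonneg _) (by linarith)
    _ = vol * (2 * l₀ * c * b ^ (K - j)) := by ring

omit [DecidableEq ι] in
/-- Slot count × per-slot amplitude profile ⇒ the slice sums of the squared amplitudes: if every scale-`j` slot has amplitude
`0 ≤ amp K X ≤ c₁·θ₁^{K−j}` and there are at most `vol·Λ^{K−j}` of them, then `Σ_{sc X = j} (amp K X)² ≤ vol·c₁²·(θ₁²·Λ)^{K−j}`.
[folklore] -/
theorem sum_sq_amp_le {amp : ℕ → D → ℝ} {c₁ θ₁ Λ : ℝ}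
    (hampX : ∀ K (τ : ι), ∀ X ∈ wf K τ, 0 ≤ amp K X ∧ amp K X ≤ c₁ * θ₁ ^ (K - sc K X))
    (hcount : ∀ K (τ : ι), ∀ j ≤ K, (((wf K τ).filter fun X => sc K X = j).card : ℝ) ≤ vol * Λ ^ (K - j))
    (K : ℕ) (τ : ι) :
    ∀ j ≤ K, ∑ X ∈ wf K τ with sc K X = j, amp K X ^ 2 ≤ vol * (c₁ ^ 2 * (θ₁ ^ 2 * Λ) ^ (K - j)) := by
  intro j hj
  have hq : 0 ≤ (c₁ * θ₁ ^ (K - j)) ^ 2 := sq_nonneg _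
  calc ∑ X ∈ wf K τ with sc K X = j, amp K X ^ 2
      ≤ ∑ X ∈ wf K τ with sc K X = j, (c₁ * θ₁ ^ (K - j)) ^ 2 := by
        refine sum_le_sum fun X hX => ?_
        obtain ⟨hXw, hXj⟩ := mem_filter.mp hX
        obtain ⟨h0, h1⟩ := hampX K τ X hXw
        rw [hXj] at h1
        exact pow_le_pow_left₀ h0 h1 2
    _ = (((wf K τ).filter fun X => sc K X = j).card : ℝ) * (c₁ * θ₁ ^ (K - j)) ^ 2 := by rw [sum_const, nsmul_eq_mul]
    _ ≤ (vol * Λ ^ (K - j)) * (c₁ * θ₁ ^ (K - j)) ^ 2 := mul_le_mul_of_nonneg_right (hcount K τ j hj) hq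
    _ = vol * (c₁ ^ 2 * (θ₁ ^ 2 * Λ) ^ (K - j)) := by rw [mul_pow, mul_pow, ← pow_mul, ← pow_mul']; ring

/-- **AMPLITUDES `θ₁^{K−j}` AGAINST COUNTS `Λ^{K−j}` ⇒ `OldInfluenceBudget` WITH RATIO `θ₁²·Λ`.**  Centred decoupled slots
(`|Δ K t τ s X| ≤ 2|s|·(amp K X)²`, §3) of amplitude `≤ c₁·θ₁^{K − sc X}` (the loop's UV-irrelevance read on the slot) and at most
`vol·Λ^{K−j}` slots per scale give `OldInfluenceBudget l₀ T Bad wf sc Δ vol (2·l₀·c₁²) (θ₁²·Λ)`.  With `θ₁ = L⁻³`, `Λ = L⁴`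
(`d = 4`) the ratio is `L⁻² < 1` (ne7's `Spine.NE7.rate_secondOrder_lt_one`); the uncentred first-order bounds `|Δ| ≤ 2·amp`
would give the ratio `θ₁·Λ = L > 1` (`Spine.NE7.one_lt_rate_firstOrder`) — «only second-order bookings close». [folklore] -/
theorem oldInfluenceBudget_of_amplitudes {amp : ℕ → D → ℝ} {c₁ θ₁ Λ : ℝ}
    (hΔ : ∀ K (t : ℝ), |t| ≤ l₀ → ∀ τ ∈ T K \ Bad K t, ∀ s : ℝ, |s| ≤ l₀ →
      ∀ X ∈ wf K τ, |Δ K t τ s X| ≤ 2 * |s| * amp K X ^ 2)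
    (hampX : ∀ K (τ : ι), ∀ X ∈ wf K τ, 0 ≤ amp K X ∧ amp K X ≤ c₁ * θ₁ ^ (K - sc K X))
    (hcount : ∀ K (τ : ι), ∀ j ≤ K, (((wf K τ).filter fun X => sc K X = j).card : ℝ) ≤ vol * Λ ^ (K - j)) :
    OldInfluenceBudget l₀ T Bad wf sc Δ vol (2 * l₀ * c₁ ^ 2) (θ₁ ^ 2 * Λ) :=
  oldInfluenceBudget_of_sq_amplitudes hΔ fun K τ => sum_sq_amp_le hampX hcount K τ

/-- The two letters, side by side (ne7's `QLaBudget`, re-exported for the reader of this file): in `d = 4` with `θ₁ = L⁻³` and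
`Λ = L⁴`, the second-order ratio `θ₁²Λ = L⁻²` is `< 1` and the first-order ratio `θ₁Λ = L` is `> 1`. [folklore] -/
theorem secondOrder_lt_one_lt_firstOrder {L : ℝ} (hL : 1 < L) :
    (L⁻¹ ^ 3) ^ 2 * L ^ 4 < 1 ∧ 1 < L⁻¹ ^ 3 * L ^ 4 :=
  ⟨Spine.NE7.rate_secondOrder_lt_one hL, Spine.NE7.one_lt_rate_firstOrder hL⟩

end Ledger

/-! ## §5 The general law: the influence of a re-weighting is a tilted covariance — where decoupling enters -/

section Reweighting

open scoped NNReal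

variable {Ω : Type*} {mΩ : MeasurableSpace Ω} {ν : Measure Ω} [IsFiniteMeasure ν] {F : Ω → ℝ} {B : ℝ}

/-- **THE INFLUENCE OF A RE-WEIGHTING IS A TILTED COVARIANCE OVER A TILTED MEAN** (no product structure).  `ν` finite and
nonzero, `F` measurable with `|F| ≤ B`, `r : Ω → ℝ≥0` a measurable density ratio (the re-sampled law is `ν.withDensity r`), and
`ν_s := ν.tilted (sF)` (a probability law).  If `∫ r dν_s ≠ 0` then
`tiltedMean F (ν.withDensity r) s − tiltedMean F ν s = (∫ F·r dν_s − (∫ F dν_s)·(∫ r dν_s)) ∕ ∫ r dν_s`.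
So the ONE input a producer owes per slot is a bound on `Cov_{ν_s}(F, r)` — the covariance of the loop variable with the
slot-local density ratio under the TILTED class law: exact splitting for a product law (§2–§3), cluster-expansion decoupling of the
far holonomy plus §1's second order for the near part in Bałaban's setting ([B13] §§1–2 KIND; NOT asserted). [folklore] -/
theorem influence_eq_cov_div [NeZero ν] (hFm : Measurable F) (hF : ∀ ω, |F ω| ≤ B) {r : Ω → ℝ≥0} (hrm : Measurable r)
    (s : ℝ) (h0 : ∫ ω, (r ω : ℝ) ∂(ν.tilted fun ω => s * F ω) ≠ 0) :
    tiltedMean F (ν.withDensity fun ω => r ω) s - tiltedMean F ν s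
      = ((∫ ω, F ω * r ω ∂(ν.tilted fun ω => s * F ω))
          - (∫ ω, F ω ∂(ν.tilted fun ω => s * F ω)) * (∫ ω, (r ω : ℝ) ∂(ν.tilted fun ω => s * F ω)))
        / ∫ ω, (r ω : ℝ) ∂(ν.tilted fun ω => s * F ω) := by
  set Z := ∫ ω, Real.exp (s * F ω) ∂ν with hZ
  have hZpos : 0 < Z := T4GenFunBounds.mgf_pos_of_abs_le hFm.aemeasurable (ae_of_all _ hF) s
  -- every tilted integral is an untilted one divided by `Z`
  have htilt : ∀ g : Ω → ℝ, ∫ ω, g ω ∂(ν.tilted fun ω => s * F ω) = (∫ ω, Real.exp (s * F ω) * g ω ∂ν) / Z := by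
    intro g
    rw [integral_tilted, ← integral_div]
    refine integral_congr_ae (ae_of_all _ fun ω => ?_)
    simp only [smul_eq_mul]
    ring
  -- the re-weighted numerator and denominator in terms of `ν`
  have hnum : ∫ ω, F ω * Real.exp (s * F ω) ∂(ν.withDensity fun ω => r ω)
      = ∫ ω, Real.exp (s * F ω) * (F ω * r ω) ∂ν := by
    rw [integral_withDensity_eq_integral_smul hrm]
    refine integral_congr_ae (ae_of_all _ fun ω => ?_)
    simp only [NNReal.smul_def, smul_eq_mul]
    ring
  have hden : ∫ ω, Real.exp (s * F ω) ∂(ν.withDensity fun ω => r ω) = ∫ ω, Real.exp (s * F ω) * (r ω : ℝ) ∂ν := by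
    rw [integral_withDensity_eq_integral_smul hrm]
    refine integral_congr_ae (ae_of_all _ fun ω => ?_)
    simp only [NNReal.smul_def, smul_eq_mul]
    ring
  have hA := htilt fun ω => F ω * r ω
  have hR := htilt fun ω => (r ω : ℝ)
  have hC := htilt fun ω => F ω
  rw [tiltedMean_eq_div F (ν.withDensity fun ω => r ω), hnum, hden, tiltedMean]
  rw [hA, hR, hC]
  have hRZ : (∫ ω, Real.exp (s * F ω) * (r ω : ℝ) ∂ν) ≠ 0 := by
    intro h; apply h0; rw [hR, h, zero_div]
  field_simp

end Reweighting

/-! ## §6 Consistency: re-sampling a decoupled slot as a density ratio — §5's identity and §3's influence describe the same number -/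

section Bridge

open scoped NNReal

variable {Ω S : Type*} {mΩ : MeasurableSpace Ω} {mS : MeasurableSpace S}
  {ρ : Measure Ω} {κ : Measure S} [IsFiniteMeasure ρ] [IsFiniteMeasure κ] {G : Ω → ℝ} {h : S → ℝ} {B a : ℝ}

/-- **THE TWO DESCRIPTIONS OF A RE-SAMPLED SLOT AGREE.**  Under a product law `ρ ⊗ κ`, re-weighting by a SLOT-LOCAL density ratio
`q ∘ snd` is the same measure as re-sampling the slot (`ρ ⊗ κ.withDensity q`, Mathlib `prod_withDensity_right`); hence the
re-weighting influence of §5 equals §3's `tiltedMean h (κ.withDensity q) s − tiltedMean h κ s` — the rest cancels and only the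
slot's own tilted covariance survives. [folklore] -/
theorem influence_withDensity_snd [NeZero ρ] [NeZero κ] {q : S → ℝ≥0} (hq : Measurable q)
    [NeZero (κ.withDensity fun x => q x)] [IsFiniteMeasure (κ.withDensity fun x => q x)]
    (hGm : Measurable G) (hG : ∀ ω, |G ω| ≤ B) (hhm : Measurable h) (hh : ∀ x, |h x| ≤ a) (s : ℝ) :
    tiltedMean (fun p : Ω × S => G p.1 + h p.2) ((ρ.prod κ).withDensity fun p => q p.2) s
      - tiltedMean (fun p : Ω × S => G p.1 + h p.2) (ρ.prod κ) s
      = tiltedMean h (κ.withDensity fun x => q x) s - tiltedMean h κ s := by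
  have e : ρ.prod (κ.withDensity fun x => (q x : ENNReal)) = (ρ.prod κ).withDensity fun p => (q p.2 : ENNReal) :=
    prod_withDensity_right hq.coe_nnreal_ennreal
  rw [← e]
  exact influence_eq hGm hG hhm hh s

end Bridge

end Summit.QuantumFields.BalabanUV.T4Continuum.NE1p.TiltedMeanInfluence

end
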